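import Summits.QuantumFields.YangMills.Theorems.FlatTubeReductionCoreAmplitudes
import Summits.QuantumFields.YangMills.Theorems.FlatTubeReductionMomentTransport
import HarnessLib

/-!
# The gauge-deviation moment weight is dominated by the kinetic level weight on the Faddeev–Popov slice

Support file for the crux `NearFlatRatioLaw` (line `ratepack_v2`, stub `stub_hODpot_A`, step (R3b-i) of
`Cruxes/NearFlatRatioLaw/Lines/ratepack-v7-moments-g18.md` §10).

The fibre factors of the `(C2)`-moments core bound are colour-localised BO kernels with the reweighted Faddeev–Popov weight
`W·(1 + βG)^j`, `G(g) = Σ_y ‖q(g_y) − 1‖²` (`…FibreFactorReweighted`).  On the Faddeev–Popov slice (`colourMean g ∈ fpBall ε`,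
`βε² ≤ 1`) the gauge deviation is controlled by the kinetic defect of the pair and the two fibre radii
(`…CoreAmplitudes.amp_le_on_core` when the configuration is small, the crude `G ≤ 4|Λ|` otherwise):
`1 + βG ≤ C_L·(1 + β·kinDefect + β‖x‖² + β‖x'‖²)`, `C_L = 1 + |Λ|(24300L² + 2)` (`one_add_beta_gaugeDev_le_levelWeight`), hence
`(1 + βG)^j ≤ C_L^j (1 + β·kinDefect + β‖x‖² + β‖x'‖²)^j` — exactly the level weight of `…ReweightedProfile.integral_levelWeight_le_reweighted`,
which moves it onto the reweighted profile and leaves the kinetic moments of `…ReferenceMoments.reference_moment_le`.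
-/

noncomputable section

open MeasureTheory Filter Topology Real
open scoped BigOperators
open Literature.MathematicalPhysics.QuantumFieldTheory
open Literature.MathematicalPhysics.QuantumLattice

namespace Summit.QuantumFields.YangMills.Theorems.FemtoTransferGap.TwoLattice.ConstTube

open Summit.QuantumFields.YangMills.Theorems.FemtoTransferGap
open Summit.QuantumFields.YangMills.Theorems.FemtoTransferGap.TwoLattice
open Summit.QuantumFields.YangMills.Theorems.FemtoTransferGap.TwoLattice.Avg
open Summit.QuantumFields.YangMills.Theorems.FemtoTransferGap.TwoLattice.Stiff (LinkSpace)

variable {L : ℕ} [NeZero L]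

/-- ★★ **`1 + βG ≤ C_L(1 + β·kin + β‖x‖² + β‖x'‖²)` on the Faddeev–Popov slice.**  `β ≥ 0`, `βε² ≤ 1`, fibre points with `Σ_a v_{e,a}² ≤ 1`,
`colourMean g ∈ fpBall ε`. [folklore] -/
theorem one_add_beta_gaugeDev_le_levelWeight {β ε : ℝ} (hβ : 0 ≤ β) (hε : β * ε ^ 2 ≤ 1) {v v' : Edge 3 L → Fin 3 → ℝ}
    (hv1 : ∀ e, ∑ a, v e a ^ 2 ≤ 1) (hv'1 : ∀ e, ∑ a, v' e a ^ 2 ≤ 1) {g : Site 3 L → SU2} (hW : colourMean L g ∈ fpBall ε) :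
    1 + β * ∑ y, ‖su2Quat (g y) - 1‖ ^ 2 ≤
      (1 + (Fintype.card (Site 3 L) : ℝ) * (24300 * (L : ℝ) ^ 2 + 2)) *
        (1 + β * kinDefect L (orthoTube L 1 v) (orthoTube L 1 v') g + β * ‖linkEmbed L v‖ ^ 2 + β * ‖linkEmbed L v'‖ ^ 2) := by
  have hkin := kinDefect_nonneg (L := L) (orthoTube L 1 v) (orthoTube L 1 v') g
  have hN0 : (0 : ℝ) ≤ (Fintype.card (Site 3 L) : ℝ) := Nat.cast_nonneg _
  have hL1 : (1 : ℝ) ≤ (L : ℝ) := by exact_mod_cast Nat.one_le_iff_ne_zero.mpr (NeZero.ne L)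
  have hG := gaugeDevSq_mem g
  -- the size parameter `σ = √kin + 5√2‖x‖ + √2‖x'‖` and its square
  set σ : ℝ := Real.sqrt (kinDefect L (orthoTube L 1 v) (orthoTube L 1 v') g) + 5 * Real.sqrt 2 * ‖linkEmbed L v‖ + Real.sqrt 2 * ‖linkEmbed L v'‖ with hσ
  have hσ0 : 0 ≤ σ := by rw [hσ]; positivity
  have hσ2 : σ ^ 2 ≤ 150 * (kinDefect L (orthoTube L 1 v) (orthoTube L 1 v') g + ‖linkEmbed L v‖ ^ 2 + ‖linkEmbed L v'‖ ^ 2) := by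
    have h2 : Real.sqrt 2 ^ 2 = 2 := Real.sq_sqrt (by norm_num)
    have hk : Real.sqrt (kinDefect L (orthoTube L 1 v) (orthoTube L 1 v') g) ^ 2 = kinDefect L (orthoTube L 1 v) (orthoTube L 1 v') g := Real.sq_sqrt hkin
    have h3 : σ ^ 2 ≤ 3 * (Real.sqrt (kinDefect L (orthoTube L 1 v) (orthoTube L 1 v') g) ^ 2 + (5 * Real.sqrt 2 * ‖linkEmbed L v‖) ^ 2 + (Real.sqrt 2 * ‖linkEmbed L v'‖) ^ 2) := by
      rw [hσ]
      nlinarith [sq_nonneg (Real.sqrt (kinDefect L (orthoTube L 1 v) (orthoTube L 1 v') g) - 5 * Real.sqrt 2 * ‖linkEmbed L v‖),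
        sq_nonneg (Real.sqrt (kinDefect L (orthoTube L 1 v) (orthoTube L 1 v') g) - Real.sqrt 2 * ‖linkEmbed L v'‖),
        sq_nonneg (5 * Real.sqrt 2 * ‖linkEmbed L v‖ - Real.sqrt 2 * ‖linkEmbed L v'‖)]
    have e1 : (5 * Real.sqrt 2 * ‖linkEmbed L v‖) ^ 2 = 50 * ‖linkEmbed L v‖ ^ 2 := by rw [mul_pow, mul_pow, h2]; ring
    have e2 : (Real.sqrt 2 * ‖linkEmbed L v'‖) ^ 2 = 2 * ‖linkEmbed L v'‖ ^ 2 := by rw [mul_pow, h2]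
    rw [hk, e1, e2] at h3
    nlinarith [sq_nonneg ‖linkEmbed L v‖, sq_nonneg ‖linkEmbed L v'‖]
  -- abbreviate the level quantity
  set Λ : ℝ := kinDefect L (orthoTube L 1 v) (orthoTube L 1 v') g + ‖linkEmbed L v‖ ^ 2 + ‖linkEmbed L v'‖ ^ 2 with hΛ
  have hΛ0 : 0 ≤ Λ := by rw [hΛ]; positivity
  have hβΛ : 0 ≤ β * Λ := mul_nonneg hβ hΛ0
  -- the two cases
  have hGle : β * ∑ y, ‖su2Quat (g y) - 1‖ ^ 2 ≤ (Fintype.card (Site 3 L) : ℝ) * (24300 * (L : ℝ) ^ 2 + 2) * (1 + β * Λ) := by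
    by_cases hsmall : 3 * L * σ < 1
    · -- small: the core amplitude bound
      have hamp : ∀ y, ‖su2Quat (g y) - 1‖ ≤ 9 * L * σ + ε := fun y => by
        have h := RateTube.amp_le_on_core (L := L) hv1 hv'1 hW (by rw [hσ] at hsmall; exact hsmall) y
        rw [hσ]; exact h
      have hε0 : 0 ≤ 9 * L * σ + ε := (norm_nonneg _).trans (hamp 0)
      have hy : ∀ y, ‖su2Quat (g y) - 1‖ ^ 2 ≤ 2 * (81 * (L : ℝ) ^ 2 * σ ^ 2) + 2 * ε ^ 2 := fun y => by
        have h1 : ‖su2Quat (g y) - 1‖ ^ 2 ≤ (9 * L * σ + ε) ^ 2 := pow_le_pow_left₀ (norm_nonneg _) (hamp y) 2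
        nlinarith [sq_nonneg (9 * L * σ - ε)]
      have hsum : ∑ y, ‖su2Quat (g y) - 1‖ ^ 2 ≤ (Fintype.card (Site 3 L) : ℝ) * (2 * (81 * (L : ℝ) ^ 2 * σ ^ 2) + 2 * ε ^ 2) := by
        calc ∑ y, ‖su2Quat (g y) - 1‖ ^ 2 ≤ ∑ _y : Site 3 L, (2 * (81 * (L : ℝ) ^ 2 * σ ^ 2) + 2 * ε ^ 2) := Finset.sum_le_sum fun y _ => hy y
          _ = (Fintype.card (Site 3 L) : ℝ) * (2 * (81 * (L : ℝ) ^ 2 * σ ^ 2) + 2 * ε ^ 2) := by rw [Finset.sum_const, Finset.card_univ, nsmul_eq_mul]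
      have h1 : β * (2 * (81 * (L : ℝ) ^ 2 * σ ^ 2) + 2 * ε ^ 2) ≤ 24300 * (L : ℝ) ^ 2 * (β * Λ) + 2 := by
        have := mul_le_mul_of_nonneg_left hσ2 (by positivity : 0 ≤ β * (162 * (L : ℝ) ^ 2))
        nlinarith
      calc β * ∑ y, ‖su2Quat (g y) - 1‖ ^ 2 ≤ β * ((Fintype.card (Site 3 L) : ℝ) * (2 * (81 * (L : ℝ) ^ 2 * σ ^ 2) + 2 * ε ^ 2)) := mul_le_mul_of_nonneg_left hsum hβ
        _ = (Fintype.card (Site 3 L) : ℝ) * (β * (2 * (81 * (L : ℝ) ^ 2 * σ ^ 2) + 2 * ε ^ 2)) := by ring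
        _ ≤ (Fintype.card (Site 3 L) : ℝ) * (24300 * (L : ℝ) ^ 2 * (β * Λ) + 2) := mul_le_mul_of_nonneg_left h1 hN0
        _ ≤ (Fintype.card (Site 3 L) : ℝ) * (24300 * (L : ℝ) ^ 2 + 2) * (1 + β * Λ) := by nlinarith
    · -- large: `1 ≤ 3Lσ`, so `β ≤ 9L²βσ² ≤ 1350 L² βΛ`, and `G ≤ 4|Λ|`
      have hge : 1 ≤ 3 * L * σ := not_lt.mp hsmall
      have h1 : (1 : ℝ) ≤ 9 * (L : ℝ) ^ 2 * σ ^ 2 := by nlinarith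
      have h1' : (1 : ℝ) ≤ 1350 * (L : ℝ) ^ 2 * Λ := by
        have := mul_le_mul_of_nonneg_left hσ2 (by positivity : (0 : ℝ) ≤ 9 * (L : ℝ) ^ 2)
        nlinarith
      have h2 : β ≤ 1350 * (L : ℝ) ^ 2 * (β * Λ) := by
        have := mul_le_mul_of_nonneg_left h1' hβ
        nlinarith
      calc β * ∑ y, ‖su2Quat (g y) - 1‖ ^ 2 ≤ β * (4 * Fintype.card (Site 3 L)) := mul_le_mul_of_nonneg_left hG.2 hβ
        _ = 4 * (Fintype.card (Site 3 L) : ℝ) * β := by ring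
        _ ≤ 4 * (Fintype.card (Site 3 L) : ℝ) * (1350 * (L : ℝ) ^ 2 * (β * Λ)) := mul_le_mul_of_nonneg_left h2 (by positivity)
        _ ≤ (Fintype.card (Site 3 L) : ℝ) * (24300 * (L : ℝ) ^ 2 + 2) * (1 + β * Λ) := by nlinarith
  have e : 1 + β * kinDefect L (orthoTube L 1 v) (orthoTube L 1 v') g + β * ‖linkEmbed L v‖ ^ 2 + β * ‖linkEmbed L v'‖ ^ 2 = 1 + β * Λ := by rw [hΛ]; ring
  rw [e]
  have e2 : (1 + (Fintype.card (Site 3 L) : ℝ) * (24300 * (L : ℝ) ^ 2 + 2)) * (1 + β * Λ) =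
      1 + β * Λ + (Fintype.card (Site 3 L) : ℝ) * (24300 * (L : ℝ) ^ 2 + 2) * (1 + β * Λ) := by ring
  rw [e2]
  linarith [hGle, hβΛ]

/-- ★★ **Powers**: `(1 + βG)^j ≤ C_L^j·(1 + β·kin + β‖x‖² + β‖x'‖²)^j` on the Faddeev–Popov slice. [folklore] -/
theorem one_add_beta_gaugeDev_pow_le_levelWeight {β ε : ℝ} (hβ : 0 ≤ β) (hε : β * ε ^ 2 ≤ 1) {v v' : Edge 3 L → Fin 3 → ℝ}
    (hv1 : ∀ e, ∑ a, v e a ^ 2 ≤ 1) (hv'1 : ∀ e, ∑ a, v' e a ^ 2 ≤ 1) {g : Site 3 L → SU2} (hW : colourMean L g ∈ fpBall ε) (j : ℕ) :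
    (1 + β * ∑ y, ‖su2Quat (g y) - 1‖ ^ 2) ^ j ≤
      (1 + (Fintype.card (Site 3 L) : ℝ) * (24300 * (L : ℝ) ^ 2 + 2)) ^ j *
        (1 + β * kinDefect L (orthoTube L 1 v) (orthoTube L 1 v') g + β * ‖linkEmbed L v‖ ^ 2 + β * ‖linkEmbed L v'‖ ^ 2) ^ j := by
  rw [← mul_pow]
  have h0 : 0 ≤ 1 + β * ∑ y, ‖su2Quat (g y) - 1‖ ^ 2 := by nlinarith [(gaugeDevSq_mem g).1]
  exact pow_le_pow_left₀ h0 (one_add_beta_gaugeDev_le_levelWeight hβ hε hv1 hv'1 hW) j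

end Summit.QuantumFields.YangMills.Theorems.FemtoTransferGap.TwoLattice.ConstTube

end
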